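import Mathlib
import Literature.Geometry.Manifold.InverseFunctionTheorem
import HarnessLib

/-!
# Level sets with split-surjective differential: the Chruściel–Delay splitting lemma and finite-parameter families with prescribed kernel tangents

Topic `Literature/Analysis/Calculus`. The functional-analytic skeleton of "the solutions of a
non-linear equation `v = const` near a point `x₀` at which `Dv(x₀)` is surjective with
complemented kernel form a submanifold modelled on `ker Dv(x₀)`, hence every finite family of
kernel vectors is the family of tangents at `x₀` of a smooth finite-parameter family of
solutions". This is how Chruściel–Delay obtain manifolds (and curves) of solutions of the general
relativistic constraint equations (P. T. Chruściel, E. Delay, *Manifold structures for sets of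
solutions of the general relativistic constraint equations*, J. Geom. Phys. 51 (2004) 442–472 =
gr-qc/0309001, **Prop. 2.3** with **Appendix A, Lemma A.1**), and it is step (ii) of the assembly
of the named fact `Literature.Geometry.Lorentzian.ChruscielDelay_localConstraintDeformation`
(file `Literature/Geometry/Lorentzian/LocalConstraintDeformation.lean`): "composing a submanifold
chart with `c ↦ Σ cⱼ (bⱼ, aⱼ)` gives a smooth `k`-parameter family on a ball `N ∋ 0` with these
tangents". Everything here is PROVED (Mathlib's implicit function theorem for a complemented
kernel, `HasStrictFDerivAt.implicitFunctionOfComplemented`, does the work); no definitions, no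
named facts.

* §1 **Chruściel–Delay 2004, Lemma A.1 (the splitting).** `E, F, G` Banach, `B : E → F` and
  `A : F → G` continuous linear (`B = Du(0)`, `A = Dv(0)` in the source) with `A ∘ B` an
  isomorphism `L : E ≃ G`. Then `A` is onto (`range_eq_top_of_comp_eq_equiv`), `ker A` is
  complemented, by the continuous projection `x ↦ x − B L⁻¹ A x`
  (`closedComplemented_ker_of_comp_eq_equiv`), `F = range B ⊕ ker A`
  (`isCompl_range_ker_of_comp_eq_equiv`) and `range B` is closed
  (`isClosed_range_of_comp_eq_equiv`) — "it easily follows that `F = Im Du(0) ⊕ Ker Dv(0)`, with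
  both summands closed" (loc. cit.). In the source `u = Du(0) = ψ²Φ²P*`, `Dv(0) = ψ⁻²P` and
  `L = Dv(0) ∘ Du(0)` is the isomorphism of their Theorem 3.6/5.9 (Mém. SMF 94 (2003)).
* §2 **The implicit function is `Cⁿ` on a neighbourhood** (`contDiffOn_implicitFunction_nhds`):
  Mathlib proves `ContDiffAt` of `ImplicitFunctionData.implicitFunction` at the base point only
  (`ImplicitFunctionData.contDiffAt_implicitFunction`), which for `n = ∞` does not even give
  smoothness on any fixed neighbourhood; if the two defining maps are `Cⁿ` on a neighbourhood of
  the base point, the (uncurried) implicit function is `Cⁿ` on an open neighbourhood `T` of the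
  base value, injective there, with values in the prescribed neighbourhood, and is a right inverse
  of `(leftFun, rightFun)` on `T` (shrink the source of the local homeomorphism to where the
  derivative stays invertible; `Literature.Geometry.Manifold.contDiffOn_symm_of_forall_hasFDerivAt_equiv`).
* §3 **Finite-parameter families with prescribed kernel tangents**
  (`exists_family_of_mem_ker`): `v : F → G` of class `Cⁿ` (`n ≠ 0`) near `x₀`, `Dv(x₀) = A`
  onto with complemented kernel, `w₁, …, w_k ∈ ker A`. Then there are `r > 0` and
  `γ : ℝᵏ → F`, `Cⁿ` on the ball `‖c‖ < r`, with `γ 0 = x₀`, `v (γ c) = v x₀` on the ball,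
  strict differential `c ↦ Σ cⱼ wⱼ` at `0` — so `d/ds γ(s eⱼ)|₀ = wⱼ` — and `γ` injective on the
  ball when the `wⱼ` are linearly independent (`γ c :=` Mathlib's implicit function at
  `(v x₀, Σ cⱼ wⱼ)`). §4 `exists_family_of_comp_eq_equiv` is the same under the hypotheses of
  Lemma A.1 (the form used in Chruściel–Delay 2004, Prop. 2.3).

## References

* P. T. Chruściel, E. Delay, J. Geom. Phys. 51 (2004) 442–472, gr-qc/0309001, Prop. 2.3,
  Appendix A, Lemma A.1. [ChruscielDelay2004]
* S. Lang, *Fundamentals of Differential Geometry* (1999), Ch. II §2 (submersions), for the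
  submanifold statement behind §3 (as cited in loc. cit., Appendix A).
-/

noncomputable section

open scoped Topology ContDiff
open Set Filter Function

namespace Literature.Analysis.Calculus

variable {E F G : Type*} [NormedAddCommGroup E] [NormedSpace ℝ E] [NormedAddCommGroup F]
  [NormedSpace ℝ F] [NormedAddCommGroup G] [NormedSpace ℝ G]

/-! ## §1 Chruściel–Delay 2004, Lemma A.1: the splitting `F = range B ⊕ ker A` -/

section Splitting

variable (A : F →L[ℝ] G) (B : E →L[ℝ] F) (L : E ≃L[ℝ] G)

/-- Pointwise form of `A ∘ B = L`. [folklore] -/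
theorem apply_apply_of_comp_eq_equiv (h : A ∘L B = (L : E →L[ℝ] G)) (e : E) : A (B e) = L e := by
  simpa using congrArg (fun T : E →L[ℝ] G ↦ T e) h

/-- **Chruściel–Delay 2004, Lemma A.1 (surjectivity of `Dv(0)`).** If `A ∘ B` is an isomorphism
`L : E ≃ G` of Banach (here: normed) spaces then `A` is onto: `A (B (L⁻¹ g)) = g`.
[cite: ChruscielDelay2004, App. A, Lemma A.1] -/
theorem range_eq_top_of_comp_eq_equiv (h : A ∘L B = (L : E →L[ℝ] G)) : A.range = ⊤ := by
  refine eq_top_iff.2 fun g _ ↦ ⟨B (L.symm g), ?_⟩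
  rw [ContinuousLinearMap.coe_coe, apply_apply_of_comp_eq_equiv A B L h, L.apply_symm_apply]

/-- **Chruściel–Delay 2004, Lemma A.1 (the kernel of `Dv(0)` is complemented).** If `A ∘ B` is
an isomorphism `L : E ≃ G` then `x ↦ x − B L⁻¹ A x` is a continuous linear projection of `F` onto
`ker A`; in particular `ker A` is a (closed) complemented subspace.
[cite: ChruscielDelay2004, App. A, Lemma A.1] -/
theorem closedComplemented_ker_of_comp_eq_equiv (h : A ∘L B = (L : E →L[ℝ] G)) :
    A.ker.ClosedComplemented := by
  have hAB := apply_apply_of_comp_eq_equiv A B L h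
  let P : F →L[ℝ] F := ContinuousLinearMap.id ℝ F - B ∘L ((L.symm : G →L[ℝ] E) ∘L A)
  have hP : ∀ x, P x ∈ A.ker := fun x ↦ by
    simp [P, hAB]
  refine ⟨P.codRestrict A.ker hP, fun x ↦ Subtype.ext ?_⟩
  have hx : A x = 0 := x.2
  simp [P, hx]

/-- **Chruściel–Delay 2004, Lemma A.1 (the direct sum).** If `A ∘ B` is an isomorphism
`L : E ≃ G` then `F = range B ⊕ ker A`: `x = B L⁻¹ A x + (x − B L⁻¹ A x)`, and `B e ∈ ker A`
forces `L e = 0`. [cite: ChruscielDelay2004, App. A, Lemma A.1] -/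
theorem isCompl_range_ker_of_comp_eq_equiv (h : A ∘L B = (L : E →L[ℝ] G)) :
    IsCompl B.range A.ker := by
  have hAB := apply_apply_of_comp_eq_equiv A B L h
  constructor
  · rw [Submodule.disjoint_def]
    rintro x ⟨e, rfl⟩ hx
    rw [LinearMap.mem_ker, ContinuousLinearMap.coe_coe, ContinuousLinearMap.coe_coe, hAB] at hx
    have he : e = 0 := by simpa using hx
    simp [he]
  · rw [codisjoint_iff, eq_top_iff]
    rintro x -
    refine Submodule.mem_sup.2 ⟨B (L.symm (A x)), ⟨L.symm (A x), rfl⟩, x - B (L.symm (A x)), ?_, ?_⟩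
    · rw [LinearMap.mem_ker, ContinuousLinearMap.coe_coe, map_sub, hAB, L.apply_symm_apply, sub_self]
    · abel

/-- **Chruściel–Delay 2004, Lemma A.1 (the range of `Du(0)` is closed).** If `A ∘ B` is an
isomorphism `L : E ≃ G` then `range B` is the kernel of the continuous projection
`x ↦ x − B L⁻¹ A x`, hence closed. [cite: ChruscielDelay2004, App. A, Lemma A.1] -/
theorem isClosed_range_of_comp_eq_equiv (h : A ∘L B = (L : E →L[ℝ] G)) :
    IsClosed (B.range : Set F) := by
  have hAB := apply_apply_of_comp_eq_equiv A B L h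
  let P : F →L[ℝ] F := ContinuousLinearMap.id ℝ F - B ∘L ((L.symm : G →L[ℝ] E) ∘L A)
  have hker : (B.range : Set F) = (P.ker : Set F) := by
    ext x
    simp only [SetLike.mem_coe, LinearMap.mem_range, LinearMap.mem_ker,
      ContinuousLinearMap.coe_coe]
    constructor
    · rintro ⟨e, rfl⟩
      simp [P, hAB]
    · intro hx
      have hx' : x - B (L.symm (A x)) = 0 := by simpa [P] using hx
      exact ⟨L.symm (A x), (sub_eq_zero.1 hx').symm⟩
  rw [hker]
  exact P.isClosed_ker

end Splitting

/-! ## §2 The implicit function is `Cⁿ` on a neighbourhood of the base value -/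

section Implicit

variable [CompleteSpace E] [CompleteSpace F] [CompleteSpace G]

/-- **The implicit function of `Cⁿ` data is `Cⁿ` on a neighbourhood.** Let `φ` be implicit
function data (`ImplicitFunctionData`: two maps `leftFun : E → F`, `rightFun : E → G` strictly
differentiable at `pt` with onto derivatives and complementary kernels) whose two maps are `Cⁿ`,
`n ≠ 0`, on a neighbourhood `U` of `pt`. Then there is an open neighbourhood `T` of
`(leftFun pt, rightFun pt)` on which the uncurried implicit function
`Ψ := uncurry φ.implicitFunction` is `Cⁿ` and injective, takes values in `U`, and is a right
inverse of `x ↦ (leftFun x, rightFun x)`. (Restrict the local homeomorphism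
`x ↦ (leftFun x, rightFun x)` of the inverse function theorem to the open set where it is `Cⁿ`
with invertible derivative; its inverse is then `Cⁿ` at every point of the target.) Mathlib has
the pointwise statement `ImplicitFunctionData.contDiffAt_implicitFunction` only. [folklore] -/
theorem contDiffOn_implicitFunction_nhds (φ : ImplicitFunctionData ℝ E F G) {n : ℕ∞ω}
    (hn : n ≠ 0) {U : Set E} (hU : U ∈ 𝓝 φ.pt) (hl : ContDiffOn ℝ n φ.leftFun U)
    (hr : ContDiffOn ℝ n φ.rightFun U) :
    ∃ T : Set (F × G), IsOpen T ∧ φ.prodFun φ.pt ∈ T ∧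
      ContDiffOn ℝ n (uncurry φ.implicitFunction) T ∧ InjOn (uncurry φ.implicitFunction) T ∧
      ∀ p ∈ T, uncurry φ.implicitFunction p ∈ U ∧ φ.prodFun (uncurry φ.implicitFunction p) = p := by
  obtain ⟨U₀, hU₀U, hU₀o, hpt⟩ := mem_nhds_iff.1 hU
  have hn1 : 1 ≤ n := ENat.one_le_iff_ne_zero_withTop.2 hn
  have hP : ContDiffOn ℝ n φ.prodFun U₀ := (hl.mono hU₀U).prodMk (hr.mono hU₀U)
  -- the open set where `prodFun` is `Cⁿ` with invertible derivative
  set W : Set E := U₀ ∩ fderiv ℝ φ.prodFun ⁻¹' range ((↑) : (E ≃L[ℝ] F × G) → E →L[ℝ] F × G)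
    with hW
  have hWo : IsOpen W :=
    (hP.continuousOn_fderiv_of_isOpen hU₀o hn1).isOpen_inter_preimage hU₀o
      ContinuousLinearEquiv.isOpen
  have hptW : φ.pt ∈ W := ⟨hpt, _, φ.hasStrictFDerivAt.hasFDerivAt.fderiv.symm⟩
  set Ψ := φ.toOpenPartialHomeomorph.restrOpen W hWo with hΨ
  have hΨsrc : Ψ.source = φ.toOpenPartialHomeomorph.source ∩ W :=
    φ.toOpenPartialHomeomorph.restrOpen_source W hWo
  have hptΨ : φ.pt ∈ Ψ.source := by
    rw [hΨsrc]
    exact ⟨φ.pt_mem_toOpenPartialHomeomorph_source, hptW⟩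
  have hsymm : ContDiffOn ℝ n Ψ.symm Ψ.target := by
    refine Literature.Geometry.Manifold.contDiffOn_symm_of_forall_hasFDerivAt_equiv Ψ
      (g := φ.prodFun) (fun z _ ↦ rfl) hn (fun a ha ↦ hP.contDiffAt (hU₀o.mem_nhds ?_))
      fun a ha ↦ ?_
    · rw [hΨsrc] at ha
      exact ha.2.1
    · rw [hΨsrc] at ha
      obtain ⟨e, he⟩ := ha.2.2
      refine ⟨e, ?_⟩
      rw [he]
      exact ((hP.contDiffAt (hU₀o.mem_nhds ha.2.1)).differentiableAt hn).hasFDerivAt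
  refine ⟨Ψ.target, Ψ.open_target, Ψ.map_source hptΨ, hsymm, Ψ.symm.injOn, fun p hp ↦ ⟨?_, ?_⟩⟩
  · have h1 : Ψ.symm p ∈ Ψ.source := Ψ.map_target hp
    rw [hΨsrc] at h1
    exact hU₀U h1.2.1
  · exact Ψ.right_inv hp

end Implicit

/-! ## §3 Finite-parameter families in a level set with prescribed kernel tangents -/

section Families

/-- On a coordinate axis of `ℝᵏ`, `s ↦ s eⱼ` has derivative `eⱼ`. [folklore] -/
theorem hasDerivAt_euclideanSpace_single {k : ℕ} (j : Fin k) (s₀ : ℝ) :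
    HasDerivAt (fun s : ℝ ↦ EuclideanSpace.single j s) (EuclideanSpace.single j (1 : ℝ)) s₀ := by
  have h : (fun s : ℝ ↦ EuclideanSpace.single j s) =
      fun s : ℝ ↦ s • EuclideanSpace.single j (1 : ℝ) := by
    funext s
    ext i
    simp
  rw [h]
  simpa using (hasDerivAt_id s₀).smul_const (EuclideanSpace.single j (1 : ℝ))

/-- The linear map `c ↦ Σ cⱼ wⱼ` on `ℝᵏ`, evaluated. [folklore] -/
theorem sum_smulRight_proj_apply {k : ℕ} (w : Fin k → F) (c : EuclideanSpace ℝ (Fin k)) :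
    (∑ j, (EuclideanSpace.proj j).smulRight (w j) : EuclideanSpace ℝ (Fin k) →L[ℝ] F) c =
      ∑ j, c j • w j := by
  simp

/-- The linear map `c ↦ Σ cⱼ wⱼ` sends `eⱼ` to `wⱼ`. [folklore] -/
theorem sum_smulRight_proj_single {k : ℕ} (w : Fin k → F) (j : Fin k) :
    (∑ i, (EuclideanSpace.proj i).smulRight (w i) : EuclideanSpace ℝ (Fin k) →L[ℝ] F)
      (EuclideanSpace.single j (1 : ℝ)) = w j := by
  simp

variable [CompleteSpace F] [CompleteSpace G]

/-- **Kernel vectors are tangents of finite-parameter families of solutions** (the curve form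
of "the level set of a map with onto, kernel-complemented differential is a submanifold modelled
on the kernel"; Lang, *Fundamentals of Differential Geometry*, II §2; used by Chruściel–Delay,
J. Geom. Phys. 51 (2004), Prop. 2.3, for the constraint map). Let `v : F → G` between Banach
spaces be `Cⁿ`, `n ≠ 0`, on a neighbourhood `U` of `x₀`, with differential `A` at `x₀` which is
onto and has complemented kernel, and let `w₁, …, w_k ∈ ker A`. Then there are `r > 0` and a
family `γ : ℝᵏ → F`, `Cⁿ` on the ball `‖c‖ < r`, with `γ 0 = x₀`, `γ c ∈ U` and
`v (γ c) = v x₀` on the ball, with strict differential `c ↦ Σ cⱼ wⱼ` at `0` — in particular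
`d/ds γ(s eⱼ)|₀ = wⱼ` — and injective on the ball if the `wⱼ` are linearly independent. (`γ c`
is Mathlib's implicit function `HasStrictFDerivAt.implicitFunctionOfComplemented` at
`(v x₀, Σ cⱼ wⱼ)`; smoothness on a fixed ball is `contDiffOn_implicitFunction_nhds`.)
[folklore] -/
theorem exists_family_of_mem_ker {n : ℕ∞ω} (hn : n ≠ 0) {v : F → G} {U : Set F} {x₀ : F}
    (hU : U ∈ 𝓝 x₀) (hv : ContDiffOn ℝ n v U) {A : F →L[ℝ] G} (hA : HasFDerivAt v A x₀)
    (hsurj : A.range = ⊤) (hker : A.ker.ClosedComplemented) {k : ℕ} (w : Fin k → F)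
    (hw : ∀ j, A (w j) = 0) :
    ∃ (r : ℝ) (γ : EuclideanSpace ℝ (Fin k) → F), 0 < r ∧ γ 0 = x₀ ∧
      ContDiffOn ℝ n γ (Metric.ball 0 r) ∧
      (∀ c ∈ Metric.ball (0 : EuclideanSpace ℝ (Fin k)) r, γ c ∈ U ∧ v (γ c) = v x₀) ∧
      HasStrictFDerivAt γ
        (∑ j, (EuclideanSpace.proj j).smulRight (w j) : EuclideanSpace ℝ (Fin k) →L[ℝ] F) 0 ∧
      (∀ j, deriv (fun s : ℝ ↦ γ (EuclideanSpace.single j s)) 0 = w j) ∧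
      (LinearIndependent ℝ w → InjOn γ (Metric.ball 0 r)) := by
  have hs : HasStrictFDerivAt v A x₀ := by
    have h := (hv.contDiffAt hU).hasStrictFDerivAt hn
    rwa [hA.fderiv] at h
  set φ := HasStrictFDerivAt.implicitFunctionDataOfComplemented v A hs hsurj hker with hφ
  -- the linear map `c ↦ Σ cⱼ wⱼ`, into `F` and into `ker A`
  set L : EuclideanSpace ℝ (Fin k) →L[ℝ] F := ∑ j, (EuclideanSpace.proj j).smulRight (w j)
    with hL
  have hLker : ∀ c, L c ∈ A.ker := fun c ↦ by
    rw [LinearMap.mem_ker, ContinuousLinearMap.coe_coe, hL, sum_smulRight_proj_apply, map_sum]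
    simp [hw]
  set ℓ : EuclideanSpace ℝ (Fin k) →L[ℝ] A.ker := L.codRestrict A.ker hLker with hℓ
  have hℓval : ∀ c, (ℓ c : F) = L c := fun c ↦ rfl
  -- the family
  set γ : EuclideanSpace ℝ (Fin k) → F := fun c ↦ φ.implicitFunction (v x₀) (ℓ c) with hγ
  -- smoothness region of the implicit function
  have hrs : ContDiffOn ℝ n φ.rightFun U :=
    ((Classical.choose hker).contDiff.comp (contDiff_id.sub contDiff_const)).contDiffOn
  obtain ⟨T, hTo, hptT, hTsmooth, hTinj, hTprop⟩ :=
    contDiffOn_implicitFunction_nhds φ hn hU hv hrs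
  have hpt : φ.prodFun φ.pt = (v x₀, 0) := by
    simp [φ, ImplicitFunctionData.prodFun]
  -- the affine map `c ↦ (v x₀, ℓ c)` and the parameter ball
  have hιc : ContDiff ℝ n fun c : EuclideanSpace ℝ (Fin k) ↦ ((v x₀, ℓ c) : G × A.ker) :=
    contDiff_const.prodMk ℓ.contDiff
  have hι0 : ((v x₀, ℓ 0) : G × A.ker) = φ.prodFun φ.pt := by rw [hpt, map_zero]
  have hpre : (fun c : EuclideanSpace ℝ (Fin k) ↦ ((v x₀, ℓ c) : G × A.ker)) ⁻¹' T ∈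
      𝓝 (0 : EuclideanSpace ℝ (Fin k)) :=
    hιc.continuous.continuousAt.preimage_mem_nhds (by rw [hι0]; exact hTo.mem_nhds hptT)
  obtain ⟨r, hr, hball⟩ := Metric.mem_nhds_iff.1 hpre
  -- the strict derivative at `0`
  have hstrict : HasStrictFDerivAt γ L 0 := by
    have h1 : HasStrictFDerivAt (φ.implicitFunction (v x₀)) A.ker.subtypeL (ℓ 0) := by
      rw [map_zero]
      exact hs.to_implicitFunctionOfComplemented hsurj hker
    have h2 : HasStrictFDerivAt (fun c ↦ ℓ c) ℓ 0 := ℓ.hasStrictFDerivAt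
    have h3 := h1.comp (0 : EuclideanSpace ℝ (Fin k)) h2
    have hLeq : A.ker.subtypeL ∘L ℓ = L := by
      ext c
      rfl
    rw [hLeq] at h3
    exact h3
  refine ⟨r, γ, hr, ?_, ?_, fun c hc ↦ ?_, hstrict, fun j ↦ ?_, fun hli ↦ ?_⟩
  · -- `γ 0 = x₀`
    show φ.implicitFunction (v x₀) (ℓ 0) = x₀
    rw [map_zero]
    exact hs.implicitFunctionOfComplemented_apply_image hsurj hker
  · -- `Cⁿ` on the ball: `γ = uncurry (implicit function) ∘ (c ↦ (v x₀, ℓ c))`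
    exact hTsmooth.comp hιc.contDiffOn fun c hc ↦ hball hc
  · -- values in `U` and in the level set
    obtain ⟨hU', hright⟩ := hTprop _ (hball hc)
    refine ⟨hU', ?_⟩
    have h2 : φ.prodFun (γ c) = (v x₀, ℓ c) := hright
    have h3 : (φ.prodFun (γ c)).1 = ((v x₀, ℓ c) : G × A.ker).1 := congrArg Prod.fst h2
    exact h3
  · -- the tangent along the `j`-th axis
    have h0 : EuclideanSpace.single j (0 : ℝ) = (0 : EuclideanSpace ℝ (Fin k)) := by
      ext i
      simp
    have hγ' : HasFDerivAt γ L (EuclideanSpace.single j (0 : ℝ)) := by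
      rw [h0]
      exact hstrict.hasFDerivAt
    have hd : HasDerivAt (fun s : ℝ ↦ γ (EuclideanSpace.single j s))
        (L (EuclideanSpace.single j (1 : ℝ))) 0 :=
      hγ'.comp_hasDerivAt (0 : ℝ) (hasDerivAt_euclideanSpace_single j 0)
    rw [hd.deriv, hL, sum_smulRight_proj_single]
  · -- injectivity for linearly independent `wⱼ`
    intro c₁ hc₁ c₂ hc₂ hγc
    have h1 : ((v x₀, ℓ c₁) : G × A.ker) = (v x₀, ℓ c₂) := hTinj (hball hc₁) (hball hc₂) hγc
    have h1' : ℓ c₁ = ℓ c₂ := (Prod.ext_iff.1 h1).2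
    have h2 : L (c₁ - c₂) = 0 := by
      rw [map_sub, ← hℓval, ← hℓval, h1', sub_self]
    rw [hL, sum_smulRight_proj_apply] at h2
    have h3 := Fintype.linearIndependent_iff.1 hli (fun j ↦ (c₁ - c₂) j) h2
    rw [← sub_eq_zero]
    ext j
    simpa using h3 j

/-- **Chruściel–Delay 2004, Lemma A.1 with Prop. 2.3: curves of solutions from the isomorphism
`Dv(0) ∘ Du(0)`.** Let `v : F → G` be `Cⁿ`, `n ≠ 0`, near `x₀` with differential `A` at `x₀`,
and suppose there is a continuous linear `B : E → F` (in the source `B = Du(0) = ψ²Φ²P*`,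
`A = ψ⁻²P`) with `A ∘ B` an isomorphism `L : E ≃ G` of Banach spaces (their operator
`L = P Φ²ψ² P*`). Then every finite family `w₁, …, w_k ∈ ker A` is the family of axis tangents
at `0` of a `Cⁿ` family `γ` on a ball of `ℝᵏ` inside the level set `v = v x₀` through
`γ 0 = x₀` (§1 feeds `exists_family_of_mem_ker`).
[cite: ChruscielDelay2004, App. A, Lemma A.1] -/
theorem exists_family_of_comp_eq_equiv {n : ℕ∞ω} (hn : n ≠ 0) {v : F → G} {U : Set F}
    {x₀ : F} (hU : U ∈ 𝓝 x₀) (hv : ContDiffOn ℝ n v U) {A : F →L[ℝ] G}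
    (hA : HasFDerivAt v A x₀) (B : E →L[ℝ] F) (L : E ≃L[ℝ] G) (h : A ∘L B = (L : E →L[ℝ] G))
    {k : ℕ} (w : Fin k → F) (hw : ∀ j, A (w j) = 0) :
    ∃ (r : ℝ) (γ : EuclideanSpace ℝ (Fin k) → F), 0 < r ∧ γ 0 = x₀ ∧
      ContDiffOn ℝ n γ (Metric.ball 0 r) ∧
      (∀ c ∈ Metric.ball (0 : EuclideanSpace ℝ (Fin k)) r, γ c ∈ U ∧ v (γ c) = v x₀) ∧
      HasStrictFDerivAt γ
        (∑ j, (EuclideanSpace.proj j).smulRight (w j) : EuclideanSpace ℝ (Fin k) →L[ℝ] F) 0 ∧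
      (∀ j, deriv (fun s : ℝ ↦ γ (EuclideanSpace.single j s)) 0 = w j) ∧
      (LinearIndependent ℝ w → InjOn γ (Metric.ball 0 r)) :=
  exists_family_of_mem_ker hn hU hv hA (range_eq_top_of_comp_eq_equiv A B L h)
    (closedComplemented_ker_of_comp_eq_equiv A B L h) w hw

end Families

end Literature.Analysis.Calculus

end
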